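import Summits.AtomisticToContinuum.BoseEinsteinCondensation.Theorems.BECCutLineWeakDisorderWitnessTransferVanishNeZeroLift
import Summits.AtomisticToContinuum.BoseEinsteinCondensation.Theorems.BECCutLineWeakDisorderWitnessTransferZeroOne
import Literature.MathematicalPhysics.QuantumManyBody.BoseGasHardSetRadial
import HarnessLib

/-!
# Route BECCutLineWeakDisorder — crux `WitnessTransfer`, line `Sketch`, stub (S6): a.s. infinite pair action, `y ≠ 0`

Stub (S6) `stub_pairAction_ae_top_of_ne_zero`: for a hard relative position `y = xᵢ − xⱼ ≠ 0`
of `v` and `0 < t ≤ (|y|/1920)²`, `P(∫₀ᵗ v(|Bⁱ_s − Bʲ_s|) ds = ∞) ≥ 10⁻⁴/2` — product formula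
for the independent path lifts (`…Conditioning`), sections bound (`…VanishNeZeroLift`), window
masses `∫_{(|y|−√t,|y|+√t)} min(v, n) ↑ ∞` (`BoseGas.lintegral_Ioo_eq_top_of_mem_hardRad`) — and
the zero-one upgrade (`…ZeroOne`, Blumenthal (S4)) gives probability one for every `T > 0`.
-/

noncomputable section

open MeasureTheory ProbabilityTheory Filter Set Metric
open scoped ENNReal NNReal Topology

namespace Summit.AtomisticToContinuum.BoseEinsteinCondensation.Theorems.CutLineWitness

open Literature.MathematicalPhysics.QuantumManyBody.BoseGas
open Literature.Probability.Process Literature.Probability.RandomPlanarGeometry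
open scoped Literature.Probability.RandomPlanarGeometry.PathBorel

/-! ### The uniform positive probability and the stub -/

/-- **Uniform positive probability of an infinite pair action.** For a hard point
`y = xᵢ − xⱼ ≠ 0` and `0 < t ≤ (|y|/1920)²`: `P(A_t = ∞) ≥ 10⁻⁴/2`. [folklore] -/
theorem measure_pairAction_top_ge {N : ℕ} {v : ℝ → ℝ≥0∞} (hv : Measurable v) {X : Config N}
    {i j : Fin N} (hij : i ≠ j) (hz : X i - X j ∈ hardVec v) (hy : X i - X j ≠ 0) {t : ℝ}
    (ht : 0 < t) (htT : t ≤ (‖X i - X j‖ / 1920) ^ 2) :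
    ENNReal.ofReal (1 / 10000) * ENNReal.ofReal (1 / 2) ≤ wienerPaths N {ω | ∫⁻ r in Set.Ioc 0 t,
      v (dist (worldLine X ω r.toNNReal i) (worldLine X ω r.toNNReal j)) = ⊤} := by
  haveI := Literature.Probability.RandomPlanarGeometry.isProbabilityMeasure_preWienerMeasure'
  haveI : IsProbabilityMeasure (wienerPaths N) := by unfold wienerPaths; infer_instance
  set y := X i - X j with hy'
  set r₀ := ‖y‖ with hr₀
  have hr₀pos : 0 < r₀ := norm_pos_iff.2 hy
  set st := Real.sqrt t with hst
  have hst0 : 0 < st := Real.sqrt_pos.2 ht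
  have hstle : st ≤ r₀ / 1920 := by
    rw [hst, Real.sqrt_le_left (by positivity)]; exact htT
  have htr : st ≤ r₀ / 8 := hstle.trans (by linarith)
  set e : Space := ‖y‖⁻¹ • y with he
  have hen : ‖e‖ = 1 := by
    rw [he, norm_smul, norm_inv, norm_norm, inv_mul_cancel₀ (norm_ne_zero_iff.2 hy)]
  set a := Real.sqrt (r₀ * st / 48) with ha
  have ha2 : a ^ 2 = r₀ * st / 48 := Real.sq_sqrt (by positivity)
  -- the pair action
  set A : PathSpace N → ℝ≥0∞ := fun ω => ∫⁻ r in Set.Ioc 0 t,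
    v (dist (worldLine X ω r.toNNReal i) (worldLine X ω r.toNNReal j)) with hA
  have hAm : Measurable A := measurable_pairAction hv X i j t
  -- the radial and transverse processes and their lifts
  set c : Fin N × Fin 3 → ℝ := fun p => y p.2 / (Real.sqrt 2 * ‖y‖) *
    ((if p.1 = i then 1 else 0) - (if p.1 = j then 1 else 0)) with hc
  have hcU : ∀ ω : PathSpace N, Continuous fun s : ℝ≥0 => ∑ p : Fin N × Fin 3, c p * brownian s (ω p.1 p.2) :=
    fun ω => continuous_coordComb c ω
  have hUm : ∀ s : ℝ≥0, Measurable fun ω : PathSpace N => ∑ p : Fin N × Fin 3, c p * brownian s (ω p.1 p.2) :=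
    fun s => measurable_coordComb c s
  have hcV : ∀ (l : Fin 3) (ω : PathSpace N), Continuous fun s : ℝ≥0 =>
      (brownian s (ω i l) - brownian s (ω j l)) -
        (∑ l', e l' * (brownian s (ω i l') - brownian s (ω j l'))) * e l := by
    intro l ω
    refine ((continuous_brownian _).sub (continuous_brownian _)).sub (Continuous.mul ?_ continuous_const)
    exact continuous_finsetSum _ fun l' _ =>
      continuous_const.mul ((continuous_brownian _).sub (continuous_brownian _))
  have hVm : ∀ (l : Fin 3) (s : ℝ≥0), Measurable fun ω : PathSpace N =>
      (brownian s (ω i l) - brownian s (ω j l)) -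
        (∑ l', e l' * (brownian s (ω i l') - brownian s (ω j l'))) * e l := by
    intro l s
    have hb : ∀ (m : Fin N) (l : Fin 3), Measurable fun ω : PathSpace N => brownian s (ω m l) :=
      fun m l => (measurable_brownian s).comp ((measurable_pi_apply l).comp (measurable_pi_apply m))
    refine ((hb i l).sub (hb j l)).sub (Measurable.mul ?_ measurable_const)
    exact Finset.measurable_sum _ fun l' _ => ((hb i l').sub (hb j l')).const_mul _
  set ΦU : PathSpace N → C(ℝ≥0, ℝ) := toPathC (fun (s : ℝ≥0) (ω : PathSpace N) =>
    ∑ p : Fin N × Fin 3, c p * brownian s (ω p.1 p.2)) hcU with hΦU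
  set ΦV : PathSpace N → (Fin 3 → C(ℝ≥0, ℝ)) := fun ω l => toPathC (fun (s : ℝ≥0) (ω : PathSpace N) =>
    (brownian s (ω i l) - brownian s (ω j l)) -
      (∑ l', e l' * (brownian s (ω i l') - brownian s (ω j l'))) * e l) (hcV l) ω with hΦV
  have hΦUm : Measurable ΦU := measurable_toPathC hcU hUm
  have hΦVm : Measurable ΦV := measurable_pi_lambda _ fun l => measurable_toPathC (hcV l) (hVm l)
  have hind : IndepFun ΦU ΦV (wienerPaths N) := indepFun_pathLift_radial_transverse hij hy hcU hcV
  -- the transverse good set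
  set G : Set (Fin 3 → C(ℝ≥0, ℝ)) := {γ | ∀ s ≤ t.toNNReal, 2 * ∑ l, (γ l s) ^ 2 ≤ r₀ * st / 2} with hG
  have hGm : MeasurableSet G := by
    refine measurableSet_forall_le_of_continuous (F := fun (γ : Fin 3 → C(ℝ≥0, ℝ)) (s : ℝ≥0) =>
      2 * ∑ l, (γ l s) ^ 2) (fun γ => ?_) (fun s => ?_) t.toNNReal (r₀ * st / 2)
    · exact continuous_const.mul (continuous_finsetSum _ fun l _ => ((γ l).continuous).pow 2)
    · exact (Finset.measurable_sum _ fun l _ =>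
        ((measurable_pathC_eval s).comp (measurable_pi_apply l)).pow_const 2).const_mul _
  have hGbig : ENNReal.ofReal (1 / 2) ≤ ((wienerPaths N).map ΦV) G := by
    rw [Measure.map_apply hΦVm hGm]
    refine (measure_coords_small_ge_half i j hr₀pos ht htT).trans (measure_mono fun ω hω => ?_)
    intro s hs
    have hlt := transverse_sq_lt_of_runSup_lt hω e hen hs
    have hev : ∀ l, (ΦV ω l) s = (brownian s (ω i l) - brownian s (ω j l)) -
        (∑ l', e l' * (brownian s (ω i l') - brownian s (ω j l'))) * e l := fun l => rfl
    simp only [hev]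
    nlinarith [hlt, ha2]
  -- window masses
  have hWtop : ∫⁻ r in Ioo (r₀ - st) (r₀ + st), v r = ⊤ :=
    lintegral_Ioo_eq_top_of_mem_hardRad hv (mem_hardVec_iff_norm_mem_hardRad.1 hz) hst0
  set M : ℕ → ℝ≥0∞ := fun n => ∫⁻ r in Ioo (r₀ - st) (r₀ + st), min (v r) ((n + 1 : ℕ) : ℝ≥0∞) with hM
  have hM0 : ∀ n, M n ≠ 0 := fun n => lintegral_min_natCast_ne_zero hv hWtop (by omega)
  have hMmono : Monotone M := fun m n hmn =>
    lintegral_mono fun r => min_le_min_left _ (by exact_mod_cast Nat.succ_le_succ hmn)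
  have hMsup : ⨆ n, M n = ⊤ := by
    refine top_unique ?_
    rw [← hWtop, ← iSup_lintegral_min_natCast hv]
    exact iSup_le fun n => le_iSup_of_le n (lintegral_mono fun r =>
      min_le_min_left _ (by exact_mod_cast Nat.le_succ n))
  set cn : ℕ → ℝ≥0∞ := fun n => ENNReal.ofReal (st / 1000) * (M n / 2) with hcn
  have hcn_mono : Monotone cn := fun m n hmn => by
    simp only [hcn]; gcongr; exact hMmono hmn
  have hcn_sup : ⨆ n, cn n = ⊤ := by
    simp only [hcn]
    rw [← ENNReal.mul_iSup, ← ENNReal.iSup_div, hMsup, ENNReal.top_div_of_ne_top (by norm_num),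
      ENNReal.mul_top (by simp [hst0])]
  -- the occupation sets
  set S : ℕ → Set (C(ℝ≥0, ℝ) × (Fin 3 → C(ℝ≥0, ℝ))) := fun n => {q | cn n ≤
    ∫⁻ s in Ioc 0 t, indicator {u : ℝ | |u| ≤ 2 * st} (fun u =>
      indicator (Ioo (r₀ - st) (r₀ + st)) (fun r => min (v r) ((n + 1 : ℕ) : ℝ≥0∞))
        (Real.sqrt ((r₀ + 2 * u) ^ 2 + 2 * ∑ l, (q.2 l (min s t).toNNReal) ^ 2))) (q.1 s.toNNReal)}
    with hS
  have hSm : ∀ n, MeasurableSet (S n) := fun n =>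
    measurableSet_le measurable_const (measurable_pathOccupation hv (n + 1) t r₀)
  have hsec : ∀ n, ∀ γ ∈ G, ENNReal.ofReal (1 / 10000) ≤ ((wienerPaths N).map ΦU) {u | (u, γ) ∈ S n} :=
    fun n γ hγ => map_radialLift_section_ge hv hij hy ht htr n (hM0 n) hcU γ hγ
  have hprod : ∀ n, ENNReal.ofReal (1 / 10000) * ((wienerPaths N).map ΦV) G ≤
      wienerPaths N {ω | (ΦU ω, ΦV ω) ∈ S n} := fun n =>
    mul_map_le_measure_of_indepFun hΦUm hΦVm hind (hSm n) hGm (hsec n)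
  -- the occupation functional is below the pair action
  have hJle : ∀ n, {ω | (ΦU ω, ΦV ω) ∈ S n} ⊆ {ω | cn n ≤ A ω} := by
    intro n ω hω
    refine (show cn n ≤ _ from hω).trans (setLIntegral_mono' measurableSet_Ioc fun s hs => ?_)
    have hmin : min s t = s := min_eq_left hs.2
    have hevU : (ΦU ω) s.toNNReal = ∑ p : Fin N × Fin 3, c p * brownian s.toNNReal (ω p.1 p.2) := rfl
    have hevV : ∀ l, (ΦV ω l) s.toNNReal = (brownian s.toNNReal (ω i l) - brownian s.toNNReal (ω j l)) -
        (∑ l', e l' * (brownian s.toNNReal (ω i l') - brownian s.toNNReal (ω j l'))) * e l :=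
      fun l => rfl
    simp only [hmin, hevU, hevV]
    refine (indicator_le_self _ _ _).trans ((indicator_le_self _ _ _).trans ((min_le_left _ _).trans ?_))
    rw [dist_worldLine_eq_sqrt X ω s.toNNReal hy]
  -- uniform bound for each `n`
  have hn : ∀ n, ENNReal.ofReal (1 / 10000) * ENNReal.ofReal (1 / 2) ≤ wienerPaths N {ω | cn n ≤ A ω} :=
    fun n => ((mul_le_mul_right hGbig _).trans (hprod n)).trans (measure_mono (hJle n))
  -- pass to `A = ⊤`
  have hsub : (⋂ n, {ω | cn n ≤ A ω}) ⊆ {ω | A ω = ⊤} := by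
    intro ω hω
    simp only [mem_iInter, mem_setOf_eq] at hω ⊢
    by_contra hne
    obtain ⟨n, hn⟩ := lt_iSup_iff.1 ((lt_top_iff_ne_top.2 hne).trans_eq hcn_sup.symm)
    exact (lt_irrefl _) ((hω n).trans_lt hn)
  have hinter : wienerPaths N (⋂ n, {ω | cn n ≤ A ω}) = ⨅ n, wienerPaths N {ω | cn n ≤ A ω} := by
    refine Antitone.measure_iInter (fun m n hmn ω hω => (hcn_mono hmn).trans hω)
      (fun n => (measurableSet_le measurable_const hAm).nullMeasurableSet) ⟨0, measure_ne_top _ _⟩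
  calc ENNReal.ofReal (1 / 10000) * ENNReal.ofReal (1 / 2)
      ≤ ⨅ n, wienerPaths N {ω | cn n ≤ A ω} := le_iInf hn
    _ = wienerPaths N (⋂ n, {ω | cn n ≤ A ω}) := hinter.symm
    _ ≤ wienerPaths N {ω | A ω = ⊤} := measure_mono hsub

/-- **(S6)** For a hard point `y = xᵢ − xⱼ ≠ 0` of `v` (`i ≠ j`) and `T > 0`, the pair action
`∫₀ᵀ v(|Bⁱ_s − Bʲ_s|) ds` is a.s. infinite (conditioning on the transverse part (S1), the
one-dimensional estimate (S2) uniformly in small `T`, Blumenthal (S4)). [folklore] -/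
theorem stub_pairAction_ae_top_of_ne_zero {N : ℕ} {v : ℝ → ℝ≥0∞} (hv : Measurable v)
    {X : Config N} {i j : Fin N} (hij : i ≠ j) (hz : X i - X j ∈ hardVec v) (hy : X i - X j ≠ 0)
    {T : ℝ} (hT : 0 < T) :
    ∀ᵐ ω ∂wienerPaths N, ∫⁻ s in Set.Ioc 0 T,
      v (dist (worldLine X ω s.toNNReal i) (worldLine X ω s.toNNReal j)) = ⊤ := by
  have hr₀ : 0 < ‖X i - X j‖ := norm_pos_iff.2 hy
  have hp : ENNReal.ofReal (1 / 10000) * ENNReal.ofReal (1 / 2) ≠ 0 := by simp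
  exact pairAction_ae_top_of_uniform_pos hv X i j hp (T₀ := (‖X i - X j‖ / 1920) ^ 2) (by positivity)
    (fun t ht => measure_pairAction_top_ge hv hij hz hy ht.1 ht.2) hT

end Summit.AtomisticToContinuum.BoseEinsteinCondensation.Theorems.CutLineWitness

end
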